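import Mathlib
import HarnessLib
import Summits.Ventures.LatticeQCDFlow.Exactness.NCMCGeneralSpaceMonotoneRootConsistency
import Summits.Ventures.LatticeQCDFlow.Exactness.NCMCGeneralSpaceBennettRootLinearization
import Summits.Ventures.LatticeQCDFlow.Exactness.NCMCGeneralSpaceEstimatorCLT

/-!
# The central limit theorem for the root of a monotone estimating equation along an i.i.d. run

HONEST FRAMING: exact (Metropolis-corrected) sampling algorithms for lattice gauge theory;
figures of merit are autocorrelation/cost numbers at stated couplings and volumes; no
continuum-physics claim.

Venture `LatticeQCDFlow` (cell pub-lqcd), topic `Exactness`; FANOUT row 13 (`eng-snf`, GEN-15).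
NEW WORK of the cell (elementary asymptotic statistics: exact linearisation of a monotone estimating
equation, the strong law, Mathlib's CLT, Slutsky's theorem), not a published result; nothing is cited
as a fact (the "sandwich" variance of Z- and M-estimators named only).  ABSTRACT form of
`NCMCGeneralSpaceBennettRootCLT.lean` (GEN-15 (40b)), on the setting of
`NCMCGeneralSpaceMonotoneRootConsistency.lean`: a summand `ψ_d(x)` measurable in `x`, strictly
increasing in `d`, integrable, with population root `d⋆` (`E_μ ψ_{d⋆} = 0`); a measurable
"derivative at the root" `φ` with a pointwise Taylor bound
`|ψ_{d'}(x) − ψ_{d⋆}(x) − φ(x)(d' − d⋆)| ≤ L (d' − d⋆)²`; sensitivity `κ = E_μ φ > 0`, noise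
`s² = Var_μ[ψ_{d⋆}]` (`ψ_{d⋆} ∈ L²`).

## Content

* `abs_div_add_inv_lt'` — the real-variable inequality of `…BennettRootLinearization` with a general
  Lipschitz constant `L`: `ḡ ≠ 0`, `|ḡ + AΔ| ≤ LΔ²`, `|A − κ| + L|Δ| < min(κ/2, εκ²/2)` ⇒
  `|Δ/ḡ + 1/κ| < ε`.
* **`tendstoInDistribution_sqrt_mul_root_sub`** — for ANY measurable root selection `d̂_n` of the
  sample equation `Σ_{i<n} ψ_d(ω i) = 0` (`n ≥ 1`): `√n (d̂_n − d⋆) →d N(0, s²/κ²)` along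
  `Measure.infinitePi (fun _ => μ)`.  Proof as in the Bennett file: the exact identity
  `√n (d̂_n − d⋆) = [√n S̄_n(d⋆)] · Z_n`, the CLT for the sample mean `S̄_n(d⋆)` (mean `0`),
  `Z_n = (d̂_n − d⋆)/S̄_n(d⋆) → −1/κ` a.s. (root property + Taylor bound + strong law for `φ` +
  consistency of `d̂_n`), Slutsky.
  Instances: the paired Bennett equation ((40b), `L = ½`, `κ = G`, `s² = G(1 − 2G)`), the
  `a : b`-block Bennett equation of the engine with `nf ≠ nr` (companion file), any monotone
  one-parameter equation solved from independent records.

Scope / NOT CLAIMED: independent records; no rate; the Taylor bound is assumed only at `d⋆`; no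
studentization here.
-/

namespace Summit.Ventures.LatticeQCDFlow.Exactness.GeneralNCMC

open MeasureTheory ProbabilityTheory Set Filter Finset
open scoped ENNReal NNReal Topology

/-! ## The real-variable inequality with a general constant -/

/-- **If `ḡ ≠ 0`, `|ḡ + A Δ| ≤ L Δ²` and `η = |A − κ| + L|Δ|` is below `κ/2` and `ε κ²/2`, then
`|Δ/ḡ + κ⁻¹| < ε`.** -/
theorem abs_div_add_inv_lt' {κ A Δ g ε L : ℝ} (hL : 0 ≤ L) (hκ : 0 < κ) (hε : 0 < ε) (hg : g ≠ 0)
    (hlin : |g + A * Δ| ≤ L * Δ ^ 2) (h1 : |A - κ| + L * |Δ| < κ / 2)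
    (h2 : |A - κ| + L * |Δ| < ε * κ ^ 2 / 2) : |Δ / g + κ⁻¹| < ε := by
  set η := |A - κ| + L * |Δ| with hη
  have hη0 : 0 ≤ η := by positivity
  have hΔ : Δ ≠ 0 := by
    rintro rfl
    have : |g| ≤ 0 := by simpa using hlin
    exact hg (abs_nonpos_iff.1 this)
  have hΔpos : 0 < |Δ| := abs_pos.2 hΔ
  have hnum : |κ * Δ + g| ≤ |Δ| * η := by
    calc |κ * Δ + g| = |(κ - A) * Δ + (g + A * Δ)| := by ring_nf
      _ ≤ |(κ - A) * Δ| + |g + A * Δ| := abs_add_le _ _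
      _ ≤ |A - κ| * |Δ| + L * Δ ^ 2 := by rw [abs_mul, abs_sub_comm]; exact add_le_add le_rfl hlin
      _ = |Δ| * η := by rw [hη, ← sq_abs Δ]; ring
  have hden : |Δ| * (κ - η) ≤ |g| := by
    have hA : κ - |A - κ| ≤ |A| := by
      have := abs_sub_abs_le_abs_sub κ A
      rw [abs_of_pos hκ, abs_sub_comm] at this
      linarith
    have hAΔ : |A| * |Δ| - L * Δ ^ 2 ≤ |g| := by
      have : |A * Δ| ≤ |g + A * Δ| + |g| := by
        calc |A * Δ| = |(g + A * Δ) - g| := by ring_nf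
          _ ≤ |g + A * Δ| + |g| := abs_sub _ _
      rw [abs_mul] at this
      linarith
    calc |Δ| * (κ - η) = (κ - |A - κ|) * |Δ| - L * |Δ| ^ 2 := by rw [hη]; ring
      _ ≤ |A| * |Δ| - L * Δ ^ 2 := by rw [sq_abs]; nlinarith
      _ ≤ |g| := hAΔ
  have hκη : κ / 2 < κ - η := by linarith
  have hgpos : 0 < |g| := abs_pos.2 hg
  have hq : Δ / g + κ⁻¹ = (κ * Δ + g) / (g * κ) := by
    field_simp
  rw [hq, abs_div, abs_mul, abs_of_pos hκ, div_lt_iff₀ (mul_pos hgpos hκ)]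
  calc |κ * Δ + g| ≤ |Δ| * η := hnum
    _ < |Δ| * (κ - η) * κ * ε := by
        have : η < (κ - η) * κ * ε := by nlinarith
        nlinarith
    _ ≤ |g| * κ * ε := by
        have := mul_le_mul_of_nonneg_right (mul_le_mul_of_nonneg_right hden hκ.le) hε.le
        linarith
    _ = ε * (|g| * κ) := by ring

/-! ## The central limit theorem of the root -/

section IID

variable {X : Type*} [MeasurableSpace X] (μ : Measure X) [IsProbabilityMeasure μ]
variable {ψ : ℝ → X → ℝ}
variable {Ω' : Type*} [MeasurableSpace Ω'] {P' : Measure Ω'} [IsProbabilityMeasure P']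

/-- **Asymptotic normality of the root of a monotone estimating equation.**  With the setting of the
module docstring and ANY measurable root selection `d̂_n` (`Σ_{i<n} ψ_{d̂_n(ω)}(ω i) = 0`, `n ≥ 1`):
`√n (d̂_n − d⋆) →d N(0, Var_μ[ψ_{d⋆}] / (E_μ φ)²)`. -/
theorem tendstoInDistribution_sqrt_mul_root_sub (hmeas : ∀ d, Measurable (ψ d))
    (hstrict : ∀ x, StrictMono fun d => ψ d x) (hint : ∀ d, Integrable (ψ d) μ) {dstar : ℝ}
    (hroot : ∫ x, ψ dstar x ∂μ = 0) (hψ2 : MemLp (ψ dstar) 2 μ) {φ : X → ℝ} (hφm : Measurable φ)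
    (hφi : Integrable φ μ) (hκ : 0 < ∫ x, φ x ∂μ) {L : ℝ} (hL : 0 ≤ L)
    (htaylor : ∀ x d', |ψ d' x - ψ dstar x - φ x * (d' - dstar)| ≤ L * (d' - dstar) ^ 2)
    {dhat : ℕ → (ℕ → X) → ℝ} (hdm : ∀ n, Measurable (dhat n))
    (hdhat : ∀ n, 1 ≤ n → ∀ ω, ∑ i ∈ range n, ψ (dhat n ω) (ω i) = 0) {Y : Ω' → ℝ}
    (hY : HasLaw Y (gaussianReal 0 (Var[ψ dstar; μ] / (∫ x, φ x ∂μ) ^ 2).toNNReal) P') :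
    TendstoInDistribution (fun (n : ℕ) (ω : ℕ → X) => √(n : ℝ) * (dhat n ω - dstar)) atTop Y
      (fun _ => Measure.infinitePi fun _ : ℕ => μ) P' := by
  set κ := ∫ x, φ x ∂μ with hκdef
  -- Step 1: the CLT for the sample mean of `ψ_{d⋆}`, against `−κ Y ~ N(0, s²)`
  have hY₀ := hasLaw_const_mul_gaussianReal (v := Var[ψ dstar; μ]) (θ := κ) (c := -κ)
    (variance_nonneg (ψ dstar) μ) hκ.ne' (neg_sq κ) hY
  have clt := tendstoInDistribution_sqrt_mul_sampleMean_sub μ (hmeas dstar) hψ2 hY₀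
  -- Step 2: `Z_n = (d̂_n − d⋆)/S̄_n(d⋆) → −κ⁻¹` almost surely
  set Z : ℕ → (ℕ → X) → ℝ := fun n ω =>
    if sampleMean (ψ dstar) (fun i : Fin n => ω i) = 0 then -κ⁻¹
    else (dhat n ω - dstar) / sampleMean (ψ dstar) (fun i : Fin n => ω i) with hZ
  have hZmeas : ∀ n, Measurable (Z n) := fun n =>
    Measurable.ite (measurableSet_eq_fun (measurable_sampleMean_run (hmeas dstar) n) measurable_const)
      measurable_const (((hdm n).sub_const dstar).div (measurable_sampleMean_run (hmeas dstar) n))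
  have hroot' : ∀ n, 1 ≤ n → ∀ ω : ℕ → X,
      sampleMean (ψ (dhat n ω)) (fun i : Fin n => ω i) = 0 := fun n hn ω => by
    unfold sampleMean
    rw [Fin.sum_univ_eq_sum_range (fun i => ψ (dhat n ω) (ω i)) n, hdhat n hn ω, zero_div]
  have hlin : ∀ n, 1 ≤ n → ∀ ω : ℕ → X,
      |sampleMean (ψ dstar) (fun i : Fin n => ω i) +
        sampleMean φ (fun i : Fin n => ω i) * (dhat n ω - dstar)| ≤ L * (dhat n ω - dstar) ^ 2 := by
    intro n hn ω
    have hsm : sampleMean (fun x => ψ (dhat n ω) x - ψ dstar x - φ x * (dhat n ω - dstar))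
        (fun i : Fin n => ω i) =
        sampleMean (ψ (dhat n ω)) (fun i : Fin n => ω i) - sampleMean (ψ dstar) (fun i : Fin n => ω i) -
          sampleMean φ (fun i : Fin n => ω i) * (dhat n ω - dstar) := by
      unfold sampleMean
      rw [sum_sub_distrib, sum_sub_distrib, ← sum_mul]
      have hn' : (n : ℝ) ≠ 0 := by exact_mod_cast (show n ≠ 0 by omega)
      field_simp
    have hb := abs_sampleMean_le (F := fun x => ψ (dhat n ω) x - ψ dstar x - φ x * (dhat n ω - dstar))
      (y := fun i : Fin n => ω i) (B := L * (dhat n ω - dstar) ^ 2) (by positivity)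
      (fun i => htaylor (ω i) (dhat n ω))
    rw [hsm, hroot' n hn ω, zero_sub] at hb
    rw [show sampleMean (ψ dstar) (fun i : Fin n => ω i) +
        sampleMean φ (fun i : Fin n => ω i) * (dhat n ω - dstar) =
      -(-sampleMean (ψ dstar) (fun i : Fin n => ω i) -
        sampleMean φ (fun i : Fin n => ω i) * (dhat n ω - dstar)) by ring, abs_neg]
    exact hb
  have hZae : ∀ᵐ ω ∂(Measure.infinitePi fun _ : ℕ => μ), Tendsto (fun n => Z n ω) atTop (𝓝 (-κ⁻¹)) := by
    filter_upwards [tendsto_measurable_root_ae μ hmeas hstrict hint hroot hdhat,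
      tendsto_sampleMean_ae μ hφm hφi] with ω hcons hωφ
    have hη : Tendsto (fun n => |sampleMean φ (fun i : Fin n => ω i) - κ| + L * |dhat n ω - dstar|)
        atTop (𝓝 0) := by
      have h1 : Tendsto (fun n => |sampleMean φ (fun i : Fin n => ω i) - κ|) atTop (𝓝 0) := by
        have := (hωφ.sub_const κ).abs
        rwa [sub_self, abs_zero] at this
      have h2 : Tendsto (fun n => L * |dhat n ω - dstar|) atTop (𝓝 0) := by
        have := ((hcons.sub_const dstar).abs).const_mul L
        rwa [sub_self, abs_zero, mul_zero] at this
      simpa using h1.add h2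
    rw [Metric.tendsto_atTop]
    intro ε hε
    have hε1 : (0 : ℝ) < κ / 2 := by positivity
    have hε2 : (0 : ℝ) < ε * κ ^ 2 / 2 := by positivity
    obtain ⟨N, hN⟩ := (((hη.eventually (gt_mem_nhds hε1)).and (hη.eventually (gt_mem_nhds hε2))).and
      (eventually_ge_atTop 1)).exists_forall_of_atTop
    refine ⟨N, fun n hn => ?_⟩
    obtain ⟨⟨hn1, hn2⟩, hn3⟩ := hN n hn
    rw [Real.dist_eq]
    by_cases hg : sampleMean (ψ dstar) (fun i : Fin n => ω i) = 0
    · simp only [hZ, hg, ↓reduceIte, sub_self, abs_zero]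
      exact hε
    · simp only [hZ, hg, ↓reduceIte, sub_neg_eq_add]
      exact abs_div_add_inv_lt' hL hκ hε hg (hlin n hn3 ω) hn1 hn2
  have hZP : TendstoInMeasure (Measure.infinitePi fun _ : ℕ => μ) Z atTop (fun _ => -κ⁻¹) :=
    tendstoInMeasure_of_tendsto_ae (fun n => (hZmeas n).aestronglyMeasurable) hZae
  -- Step 3: Slutsky and the exact identity
  have slutsky := clt.continuous_comp_prodMk_of_tendstoInMeasure_const
    (g := fun p : ℝ × ℝ => p.1 * p.2) (by fun_prop) hZP (fun n => (hZmeas n).aemeasurable)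
  have hlim : (fun ω' => -κ * Y ω' * -κ⁻¹) = Y := by
    funext ω'
    field_simp
  simp only at slutsky
  rw [hlim] at slutsky
  refine slutsky.congr (fun n => Eventually.of_forall fun ω => ?_) EventuallyEq.rfl
  rw [hroot, sub_zero]
  symm
  by_cases hg : sampleMean (ψ dstar) (fun i : Fin n => ω i) = 0
  · simp only [hZ, hg, ↓reduceIte, zero_mul, mul_zero]
    rcases Nat.eq_zero_or_pos n with rfl | hn
    · simp
    · have hsum0 : ∑ i ∈ range n, ψ dstar (ω i) = 0 := by
        have hg' := hg
        unfold sampleMean at hg'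
        rw [Fin.sum_univ_eq_sum_range (fun i => ψ dstar (ω i)) n, div_eq_zero_iff] at hg'
        rcases hg' with hg' | hg'
        · exact hg'
        · exact absurd hg' (by exact_mod_cast hn.ne')
      have heq : dhat n ω = dstar :=
        (rootSum_strictMono hstrict ω hn).injective ((hdhat n hn ω).trans hsum0.symm)
      rw [heq, sub_self, mul_zero]
  · simp only [hZ, hg, ↓reduceIte]
    rw [mul_assoc, mul_div_cancel₀ _ hg]

end IID

end Summit.Ventures.LatticeQCDFlow.Exactness.GeneralNCMC
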